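import Summits.CriticalPhenomena.PercolationContinuityZ3.Theorems.Transplant.TriFilmHexShadow
import Mathlib.Combinatorics.SimpleGraph.Hasse
import HarnessLib

/-!
# `P_{k+1} □ 𝕋` IS THE TRIANGULAR FILM `𝕋 × {0..k}`: the graph isomorphism `pathGraph (k + 1) □ triGraph ≃g TriFilm.film k`

builds on p205010 (kernel theorem, internal audit signed; external expert review pending) — NOT used in this file.
Lane `prim-bschramm`, seat `prim-bschramm-p2` (gen 51; class C1b, METHOD = input substitution; memo `HOME/bschramm/P2-LATTICES.md` §162); helper file
(`--supports stmt-CriticalPhenomena-4575 --as helper`).  The row `F □ 𝕋` («ProdTriRoute») serves the fork-free fibres `F = P₁` (the triangular lattice) and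
`F = P₂` (two triangular layers), and names the slabs `𝕋 × P_{k+1}`, through the tree's triangular films `TriFilm.film k = (𝕋 □ ℤ)[0 ≤ z ≤ k]` («TriFilmHexShadow»;
`θ(p_c) = 0` for every `k`: «TriFilmZero» / «TriFilmSKFinalK1» / «TriFilmLinkage», p205010-free).  This file is the identification:
* `FinProdTri.pathProdEquivFilm k : Fin (k + 1) × Site 2 ≃ triFilm k`, `(i, x) ↦ (x, i)`, and **`FinProdTri.pathProdIsoFilm k : pathGraph (k + 1) □ triGraph ≃g TriFilm.film k`**
  (a path step `i ∼ i ± 1` is a vertical step of `𝕋 □ ℤ`, Mathlib `pathGraph_adj`, tree `zdGraph_adj_iff`).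
[cite: BenjaminiSchramm1996, Conj. 4 / Question 3] [cite: GrimmettPercolation1999, §1.6 p. 16]
-/

noncomputable section

namespace Summit.CriticalPhenomena.PercolationContinuityZ3.Theorems.Transplant

namespace FinProdTri

open Literature.Probability.Percolation Literature.Probability.LatticeModels SimpleGraph
open scoped Classical

/-- The layer coordinate of a film vertex is a natural number `≤ k`. [folklore] -/
theorem toNat_layer_lt {k : ℕ} (x : triFilm k) : ((x : Site 2 × Site 1).2 0).toNat < k + 1 := by
  have hx := mem_triFilm.1 x.2
  omega

/-- **`Fin (k+1) × ℤ² ≃ 𝕋 × {0..k}`**: `(i, x) ↦ (x, i)`. [folklore] -/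
def pathProdEquivFilm (k : ℕ) : Fin (k + 1) × Site 2 ≃ triFilm k where
  toFun v := ⟨(v.2, ![((v.1 : ℕ) : ℤ)]), by
    rw [mem_triFilm]
    simp only [Matrix.cons_val_zero, Nat.cast_nonneg, Nat.cast_le, true_and]
    have := v.1.2; omega⟩
  invFun x := (⟨((x : Site 2 × Site 1).2 0).toNat, toNat_layer_lt x⟩, (x : Site 2 × Site 1).1)
  left_inv v := by
    obtain ⟨i, y⟩ := v
    refine Prod.ext (Fin.ext ?_) rfl
    simp
  right_inv x := by
    obtain ⟨⟨y, s⟩, hx⟩ := x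
    have hs := (mem_triFilm.1 hx).1
    apply Subtype.ext
    refine Prod.ext rfl ?_
    ext j; fin_cases j
    simp only [Fin.zero_eta, Fin.isValue, Matrix.cons_val_zero]
    exact Int.toNat_of_nonneg hs

/-- The underlying pair of the image. [folklore] -/
@[simp] theorem coe_pathProdEquivFilm {k : ℕ} (v : Fin (k + 1) × Site 2) :
    ((pathProdEquivFilm k v : triFilm k) : Site 2 × Site 1) = (v.2, ![((v.1 : ℕ) : ℤ)]) := rfl

/-- Layers `![i] = ![j]` iff `i = j`. [folklore] -/
theorem layer_eq_iff {k : ℕ} (i j : Fin (k + 1)) : (![((i : ℕ) : ℤ)] : Site 1) = ![((j : ℕ) : ℤ)] ↔ i = j := by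
  constructor
  · intro h
    have h0 := congrFun h 0
    simp only [Matrix.cons_val_zero, Nat.cast_inj] at h0
    exact Fin.ext h0
  · rintro rfl; rfl

/-- **A vertical step of `𝕋 □ ℤ` between layers `i`, `j` is a step of the path graph.** [folklore] -/
theorem zdGraph_one_adj_layer_iff {k : ℕ} (i j : Fin (k + 1)) :
    (zdGraph 1).Adj (![((i : ℕ) : ℤ)] : Site 1) ![((j : ℕ) : ℤ)] ↔ (SimpleGraph.pathGraph (k + 1)).Adj i j := by
  rw [zdGraph_adj_iff, SimpleGraph.pathGraph_adj]
  constructor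
  · rintro ⟨l, h | h⟩
    · have h0 := congrFun h 0
      fin_cases l
      simp at h0
      omega
    · have h0 := congrFun h 0
      fin_cases l
      simp at h0
      omega
  · rintro (h | h)
    · refine ⟨0, Or.inl ?_⟩
      ext l; fin_cases l
      simp; omega
    · refine ⟨0, Or.inr ?_⟩
      ext l; fin_cases l
      simp; omega

/-- **`P_{k+1} □ 𝕋 ≃g 𝕋 × {0..k}`** — the slab of the triangular lattice with `k + 1` layers, as a box product with a path graph, IS the tree's triangular film.
[cite: BenjaminiSchramm1996, Conj. 4 / Question 3] -/
def pathProdIsoFilm (k : ℕ) : (SimpleGraph.pathGraph (k + 1) □ triGraph) ≃g TriFilm.film k where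
  toEquiv := pathProdEquivFilm k
  map_rel_iff' := by
    intro a b
    show stackedTriangularGraph.Adj ((pathProdEquivFilm k a : triFilm k) : Site 2 × Site 1) (pathProdEquivFilm k b : triFilm k) ↔ _
    rw [coe_pathProdEquivFilm, coe_pathProdEquivFilm, stackedTriangularGraph_adj, boxProd_adj, layer_eq_iff, zdGraph_one_adj_layer_iff]
    tauto

/-- `pathProdIsoFilm` on vertices. [folklore] -/
@[simp] theorem coe_pathProdIsoFilm {k : ℕ} (v : Fin (k + 1) × Site 2) :
    ((pathProdIsoFilm k v : triFilm k) : Site 2 × Site 1) = (v.2, ![((v.1 : ℕ) : ℤ)]) := rfl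

end FinProdTri

end Summit.CriticalPhenomena.PercolationContinuityZ3.Theorems.Transplant

end
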